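import Literature.Probability.RandomPlanarGeometry.HexSAWArmchairUnfoldingStep
import HarnessLib

/-!
# Beaton's fixed-length unfolding along the ARMCHAIR surface, II: strictification, flip–reversal, the weighted fibre chain
# `A_n(y) ≤ e^{O(√n log n)} Σ_{m ∈ [n, n + O(√n)]} B^w_m(y)`, and the face «ARM-ARCH-BOUND»

Topic `Literature/Probability/RandomPlanarGeometry` (continues `HexSAWArmchairUnfoldingStep.lean` — the step `ust`, `ust_spec`,
`ust_injOn_level`, `not_lt_iterate` — and `HexSAWArmchairWallBridges.lean` — `Aw`, `WB`, `armRate`, `WB_le_pow`, the face `ArchBound`;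
lane «pcv-sawmu», door «HEX-YC-ROT-LIMIT-ALL-Y», Part B2).  Sources: N. R. Beaton, J. Phys. A 47 (2014) 075003, arXiv:1210.0274v3, §3.1,
proof of Proposition 7 (p. 13: steps 5–6 of the fixed-length unfolding — steps added at the end, "we only ever add two new contacts" —,
"the number of SAWs which result in the same unfolded walk is at most e^{c√n}", and the inequality
`C^+_n(y) ≤ 4(1+1/y²) max_{0≤i≤3} e^{c√(s_i(n))} U^+_{s_i(n)}(y)`, `s_i(n) = n + ⌊3√n⌋ + i`); J. M. Hammersley, G. M. Torrie,
S. G. Whittington, J. Phys. A 15 (1982) 539, §2; N. Madras, G. Slade, *The Self-Avoiding Walk* (1993), §3.1, proof of Proposition 3.1.5.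

## What is proved (all PROVED)

* `vst` / `vst_spec` / `vst_inj` — the strictification of the top of a top-unfolded arch (three cases by the configuration at the endpoint,
  `+1/+4/+2` steps, `≤ 2` new visits), injective given its case;
* `rst` / `rst_spec` / `rst_inj` — the flip–reversal `R(ω)_i = S_M(ω_{n−i})` (`M` = the odd end level), turning a strictly top-unfolded arch
  into an arch with STRICT BOTTOM and the same visits, injective;
* `sum_pow_le_of_fibre` (weighted fibre lemma) and `sum_iterate_le` (`((L + 3k + 1) max(1,1/y)²)^k` along `k` steps);
* **`Aw_le_chain`**: `A_n(y) ≤ Φ(n,y) · Σ_{m=n}^{L₅(n)} B^w_m(y)` via the chain arches →(ust^{K₁})→(V)→(R)→(ust^{K₁(L₃)})→(V)→ armchair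
  wall bridges, `K₁(n) = ⌊√(2n)⌋ + 2`, `L₅(n) − n ≤ 38(⌊√n⌋+1)`;
* `chainFactor_le`, `Aw_le_pow` (`A_n(y) ≤ (D(⌊√n⌋+1)²)^{58(⌊√n⌋+1)} β_rot(y)ⁿ`), `eventually_chain_le_pow`, and
  **`archBound_holds : 0 < y → ArchBound y`** — for every `r > β_rot(y)`, `A_n(y) ≤ C rⁿ`.
LABEL: CONSOLIDATION (Beaton 2014 Prop. 7, proof — the unfolding bound — as a kernel theorem; multiplicity `e^{O(√n log n)}` in place of
the printed `e^{c√n}`, which is all the rate statement needs).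
-/

noncomputable section

open Finset Filter Function
open Literature.Probability.LatticeModels Literature.Probability.Percolation SimpleGraph
open _root_.Topology

namespace Literature.Probability.RandomPlanarGeometry.SAW.HexBW.Arm

variable {y : ℝ} {n : ℕ} {ω : ℕ → Site 2}

/-! ### The strictification `V` of the top: three cases by the configuration at the endpoint -/

/-- `V`, case a (endpoint of even type): append the dimer step `(0, M) → (0, M+1)`. [cite: Beaton2014RotatedHoneycomb, §3.1 (arXiv v3 p. 13, step 5: steps added at the end)] -/
def vA (n : ℕ) (ω : ℕ → Site 2) : ℕ → Site 2 := fun i => if i ≤ n then ω i else pt 0 (ω n 1 + 1)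

/-- `V`, case b (endpoint of odd type, entered up the dimer): append `(1,M), (1,M+1), (0,M+1), (0,M+2)`. [cite: Beaton2014RotatedHoneycomb, §3.1 (arXiv v3 p. 13, step 5)] -/
def vB (n : ℕ) (ω : ℕ → Site 2) : ℕ → Site 2 := fun i =>
  if i ≤ n then ω i else if i = n + 1 then pt 1 (ω n 1) else if i = n + 2 then pt 1 (ω n 1 + 1)
  else if i = n + 3 then pt 0 (ω n 1 + 1) else pt 0 (ω n 1 + 2)

/-- `V`, case c (endpoint of odd type, entered horizontally from `(1, M)`): replace the last vertex by `(1,M+1), (0,M+1), (0,M+2)`.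
[cite: Beaton2014RotatedHoneycomb, §3.1 (arXiv v3 p. 13, step 5)] -/
def vC (n : ℕ) (ω : ℕ → Site 2) : ℕ → Site 2 := fun i =>
  if i < n then ω i else if i = n then pt 1 (ω n 1 + 1) else if i = n + 1 then pt 0 (ω n 1 + 1) else pt 0 (ω n 1 + 2)

/-- The case of `V` at a state: `0` = a, `1` = b, `2` = c. [cite: Beaton2014RotatedHoneycomb, §3.1, proof of Proposition 7 (arXiv v3 pp. 12–13: the fixed-length unfolding)] -/
def vcase (σ : St) : ℕ := if (σ.2 σ.1 0 + σ.2 σ.1 1) % 2 = 0 then 0 else if σ.2 (σ.1 - 1) 0 = 0 then 1 else 2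

/-- **The strictification step `V`** on states. [cite: Beaton2014RotatedHoneycomb, §3.1 (arXiv v3 p. 13, step 5 of the fixed-length unfolding)] -/
def vst (σ : St) : St :=
  if (σ.2 σ.1 0 + σ.2 σ.1 1) % 2 = 0 then (σ.1 + 1, vA σ.1 σ.2)
  else if σ.2 (σ.1 - 1) 0 = 0 then (σ.1 + 4, vB σ.1 σ.2) else (σ.1 + 2, vC σ.1 σ.2)

/-- A top-unfolded arch state: a `C`-class walk ending on the wall at its maximal level. [cite: Beaton2014RotatedHoneycomb, §3.1 (arXiv v3 p. 12: "ending point has maximal x-coordinate")] -/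
def TopArch (σ : St) : Prop := Good σ ∧ σ.2 σ.1 0 = 0 ∧ ∀ i ≤ σ.1, σ.2 i 1 ≤ σ.2 σ.1 1

/-- A STRICTLY top-unfolded arch state with odd end level. [cite: HammersleyTorrieWhittington1982, §2 (unfolded walks)] -/
def StrictTopArch (σ : St) : Prop := Good σ ∧ σ.2 σ.1 0 = 0 ∧ (∀ i < σ.1, σ.2 i 1 < σ.2 σ.1 1) ∧ σ.2 σ.1 1 % 2 = 1

/-- The iterate `ust^[K]` of a good arch state is a top-unfolded arch once `K (K−1) > 2n`. [cite: Beaton2014RotatedHoneycomb, §3.1, proof of Proposition 7 (arXiv v3 pp. 12–13)] -/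
theorem topArch_iterate {σ : St} (hσ : Good σ) (harch : σ.2 σ.1 0 = 0) {K : ℕ} (hK : 2 * σ.1 < K * (K - 1)) : TopArch (ust^[K] σ) := by
  obtain ⟨hg, -, -, hend, -⟩ := iterate_spec hσ K
  have hnl := not_lt_iterate hσ hK
  have heq : lastTop (ust^[K] σ).1 (ust^[K] σ).2 = (ust^[K] σ).1 := le_antisymm (lastTop_le _ _) (not_lt.1 hnl)
  refine ⟨hg, by rw [hend, harch], fun i hi => ?_⟩
  have := le_maxY (n := (ust^[K] σ).1) (ust^[K] σ).2 hi
  rwa [← lastTop_spec, heq] at this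

section V

variable {σ : St} (hσ : TopArch σ)
include hσ

/-- **`V` on a top-unfolded arch**: a strictly top-unfolded `C`-class arch with odd end level, length `+1/+4/+2`, visits `+1/+2/+1`, strict
bottom preserved. [cite: Beaton2014RotatedHoneycomb, §3.1 (arXiv v3 p. 13, step 5: "we only ever add two new contacts")] -/
theorem vst_spec : StrictTopArch (vst σ) ∧ σ.1 + 1 ≤ (vst σ).1 ∧ (vst σ).1 ≤ σ.1 + 4 ∧
    visits σ.1 σ.2 ≤ visits (vst σ).1 (vst σ).2 ∧ visits (vst σ).1 (vst σ).2 ≤ visits σ.1 σ.2 + 2 ∧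
    ((∀ i, 1 ≤ i → i ≤ σ.1 → 1 ≤ σ.2 i 1) → ∀ i, 1 ≤ i → i ≤ (vst σ).1 → 1 ≤ (vst σ).2 i 1) := by
  obtain ⟨n, ω⟩ := σ
  obtain ⟨hg, hend, htop⟩ := hσ
  change ω ∈ hp n at hg
  change ω n 0 = 0 at hend
  change ∀ i ≤ n, ω i 1 ≤ ω n 1 at htop
  obtain ⟨hs, hH⟩ := mem_hp.1 hg
  obtain ⟨h0, hfr, hbw, hinj⟩ := mem_saws_iff.1 hs
  have hM0 : 0 ≤ ω n 1 := by have := htop 0 (Nat.zero_le n); rw [h0] at this; exact this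
  by_cases ha : (ω n 0 + ω n 1) % 2 = 0
  · -- case a
    have hv : vst (n, ω) = (n + 1, vA n ω) := by unfold vst; rw [if_pos ha]
    rw [hv]
    have va1 : ∀ i ≤ n, vA n ω i = ω i := fun i hi => by unfold vA; rw [if_pos hi]
    have va2 : ∀ i, n < i → vA n ω i = pt 0 (ω n 1 + 1) := fun i hi => by unfold vA; rw [if_neg (by omega)]
    have hmem : vA n ω ∈ hp (n + 1) := by
      refine mem_hp.2 ⟨mem_saws_iff.2 ⟨by rw [va1 0 (Nat.zero_le n), h0], fun i hi => by rw [va2 i (by omega), va2 (n + 1) (by omega)],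
        fun i hi => ?_, ?_⟩, fun i hi => ?_⟩
      · rcases Nat.lt_or_ge i n with h1 | h1
        · rw [va1 i h1.le, va1 (i + 1) (by omega)]; exact hbw i h1
        · have hi' : i = n := by omega
          subst hi'
          rw [va1 i le_rfl, va2 (i + 1) (by omega)]
          exact adj_of_up (by rw [pt_apply_zero, hend]) (by rw [pt_apply_one]) ha
      · intro i hi j hj hij
        simp only [Set.mem_setOf_eq] at hi hj
        rcases Nat.lt_or_ge i (n + 1) with h1 | h1 <;> rcases Nat.lt_or_ge j (n + 1) with h2 | h2
        · rw [va1 i (by omega), va1 j (by omega)] at hij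
          exact hinj (show i ∈ {i | i ≤ n} by simp; omega) (show j ∈ {i | i ≤ n} by simp; omega) hij
        · exfalso; have e := congrFun hij 1; rw [va1 i (by omega), va2 j (by omega), pt_apply_one] at e
          have := htop i (by omega); omega
        · exfalso; have e := congrFun hij 1; rw [va2 i (by omega), va1 j (by omega), pt_apply_one] at e
          have := htop j (by omega); omega
        · omega
      · rcases Nat.lt_or_ge i (n + 1) with h1 | h1
        · rw [va1 i (by omega)]; exact hH i (by omega)
        · rw [va2 i (by omega), pt_apply_zero]
    refine ⟨⟨hmem, by change vA n ω (n + 1) 0 = 0; rw [va2 _ (by omega), pt_apply_zero], fun i hi => ?_, ?_⟩,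
      by change n + 1 ≤ n + 1; omega, by change n + 1 ≤ n + 4; omega, ?_, ?_, fun hb i hi1 hi => ?_⟩
    · change vA n ω i 1 < vA n ω (n + 1) 1
      change i < n + 1 at hi
      rw [va1 i (by omega), va2 _ (by omega), pt_apply_one]; have := htop i (by omega); omega
    · change vA n ω (n + 1) 1 % 2 = 1
      rw [va2 _ (by omega), pt_apply_one]; omega
    · change visits n ω ≤ visits (n + 1) (vA n ω)
      rw [visits_succ, visits_congr (ω := vA n ω) (ξ := ω) (fun i hi => by rw [va1 i hi])]; omega
    · change visits (n + 1) (vA n ω) ≤ visits n ω + 2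
      rw [visits_succ, visits_congr (ω := vA n ω) (ξ := ω) (fun i hi => by rw [va1 i hi])]; split_ifs <;> omega
    · change 1 ≤ vA n ω i 1
      change i ≤ n + 1 at hi
      rcases Nat.lt_or_ge i (n + 1) with h1 | h1
      · rw [va1 i (by omega)]; exact hb i hi1 (by omega)
      · rw [va2 i (by omega), pt_apply_one]; omega
  · -- odd end: `M` odd, `n ≥ 1`, predecessor is `(0, M-1)` or `(1, M)`
    have hModd : ω n 1 % 2 = 1 := by rw [hend] at ha; omega
    have hn : 1 ≤ n := by
      by_contra h; have : n = 0 := by omega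
      subst this; rw [h0] at hModd; exact absurd hModd (by decide)
    have hpred : (ω (n - 1) 0 = 0 ∧ ω (n - 1) 1 + 1 = ω n 1) ∨ (ω (n - 1) 0 = 1 ∧ ω (n - 1) 1 = ω n 1) := by
      have hb := hbw (n - 1) (by omega)
      rw [show n - 1 + 1 = n by omega] at hb
      have hX := hH (n - 1) (by omega)
      have hl := htop (n - 1) (by omega)
      rcases step_cases hb with ⟨hy, hx⟩ | ⟨hx, hy, he⟩ | ⟨hx, hy, he⟩
      · right; constructor <;> omega
      · left; constructor <;> omega
      · omega
    by_cases hb0 : ω (n - 1) 0 = 0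
    · -- case b
      have hv : vst (n, ω) = (n + 4, vB n ω) := by unfold vst; rw [if_neg ha, if_pos hb0]
      rw [hv]
      have hp1 : ω (n - 1) 1 + 1 = ω n 1 := by
        rcases hpred with ⟨-, h⟩ | ⟨h, -⟩
        · exact h
        · omega
      have vb1 : ∀ i ≤ n, vB n ω i = ω i := fun i hi => by unfold vB; rw [if_pos hi]
      have vb2 : vB n ω (n + 1) = pt 1 (ω n 1) := by unfold vB; rw [if_neg (by omega), if_pos rfl]
      have vb3 : vB n ω (n + 2) = pt 1 (ω n 1 + 1) := by unfold vB; rw [if_neg (by omega), if_neg (by omega), if_pos rfl]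
      have vb4 : vB n ω (n + 3) = pt 0 (ω n 1 + 1) := by
        unfold vB; rw [if_neg (by omega), if_neg (by omega), if_neg (by omega), if_pos rfl]
      have vb5 : ∀ i, n + 4 ≤ i → vB n ω i = pt 0 (ω n 1 + 2) := fun i hi => by
        unfold vB; rw [if_neg (by omega), if_neg (by omega), if_neg (by omega), if_neg (by omega)]
      -- `(1, M)` is not on `ω`
      have hfree : ∀ i ≤ n, ¬ (ω i 0 = 1 ∧ ω i 1 = ω n 1) := by
        rintro i hi ⟨hx, hy⟩
        rcases Nat.eq_zero_or_pos i with rfl | hipos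
        · rw [h0] at hx; exact absurd hx (by decide)
        have hin : i ≠ n := by rintro rfl; omega
        have hin1 : i ≠ n - 1 := by rintro rfl; omega
        -- both walk-neighbours of `ω i = (1,M)` (even type) are among `(0,M) = ω n` and `(2,M)`
        have key : ∀ j ≤ n, brickWallGraph.Adj (ω i) (ω j) → j ≠ n → ω j 0 = 2 ∧ ω j 1 = ω n 1 := by
          intro j hj hadj hjn
          have hjl := htop j hj
          rcases step_cases hadj with ⟨hy', hx'⟩ | ⟨hx', hy', he⟩ | ⟨hx', hy', he⟩
          · by_cases hX : ω j 0 = 0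
            · exfalso
              have heq : ω j = ω n := by rw [site_two_eq_iff]; rw [hend]; constructor <;> omega
              exact hjn (hinj (show j ∈ {i | i ≤ n} by exact hj) (show n ∈ {i | i ≤ n} by simp) heq)
            · constructor <;> omega
          · omega
          · omega
        obtain ⟨a0, a1⟩ := key (i + 1) (by omega) (hbw i (by omega)) (by omega)
        have hadj0 : brickWallGraph.Adj (ω i) (ω (i - 1)) := by
          have := hbw (i - 1) (by omega); rw [show i - 1 + 1 = i by omega] at this; exact this.symm
        obtain ⟨b0, b1⟩ := key (i - 1) (by omega) hadj0 (by omega)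
        have heq : ω (i + 1) = ω (i - 1) := by rw [site_two_eq_iff]; constructor <;> omega
        have := hinj (show i + 1 ∈ {i | i ≤ n} by simp; omega) (show i - 1 ∈ {i | i ≤ n} by simp; omega) heq
        omega
      -- values/levels profile
      have prof : ∀ i ≤ n + 4, (i ≤ n ∧ vB n ω i = ω i) ∨ (i = n + 1 ∧ vB n ω i 0 = 1 ∧ vB n ω i 1 = ω n 1) ∨
          (i = n + 2 ∧ vB n ω i 0 = 1 ∧ vB n ω i 1 = ω n 1 + 1) ∨ (i = n + 3 ∧ vB n ω i 0 = 0 ∧ vB n ω i 1 = ω n 1 + 1) ∨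
          (i = n + 4 ∧ vB n ω i 0 = 0 ∧ vB n ω i 1 = ω n 1 + 2) := by
        intro i hi
        rcases Nat.lt_or_ge i (n + 1) with h1 | h1
        · exact Or.inl ⟨by omega, vb1 i (by omega)⟩
        · have hc : i = n + 1 ∨ i = n + 2 ∨ i = n + 3 ∨ i = n + 4 := by omega
          rcases hc with rfl | rfl | rfl | rfl
          · right; left; exact ⟨rfl, by rw [vb2, pt_apply_zero], by rw [vb2, pt_apply_one]⟩
          · right; right; left; exact ⟨rfl, by rw [vb3, pt_apply_zero], by rw [vb3, pt_apply_one]⟩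
          · right; right; right; left; exact ⟨rfl, by rw [vb4, pt_apply_zero], by rw [vb4, pt_apply_one]⟩
          · right; right; right; right; exact ⟨rfl, by rw [vb5 _ le_rfl, pt_apply_zero], by rw [vb5 _ le_rfl, pt_apply_one]⟩
      have hmem : vB n ω ∈ hp (n + 4) := by
        refine mem_hp.2 ⟨mem_saws_iff.2 ⟨by rw [vb1 0 (Nat.zero_le n), h0], fun i hi => by rw [vb5 i hi, vb5 (n + 4) le_rfl],
          fun i hi => ?_, ?_⟩, fun i hi => ?_⟩
        · rcases Nat.lt_or_ge i n with h1 | h1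
          · rw [vb1 i h1.le, vb1 (i + 1) (by omega)]; exact hbw i h1
          · have hc : i = n ∨ i = n + 1 ∨ i = n + 2 ∨ i = n + 3 := by omega
            rcases hc with rfl | rfl | rfl | rfl
            · rw [vb1 i le_rfl, vb2]; exact adj_of_horiz (by rw [pt_apply_one]) (Or.inl (by rw [pt_apply_zero, hend]; norm_num))
            · rw [vb2, show n + 1 + 1 = n + 2 by omega, vb3]
              exact adj_of_up (by rw [pt_apply_zero, pt_apply_zero]) (by rw [pt_apply_one, pt_apply_one]) (by rw [pt_apply_zero, pt_apply_one]; omega)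
            · rw [vb3, show n + 2 + 1 = n + 3 by omega, vb4]
              exact adj_of_horiz (by rw [pt_apply_one, pt_apply_one]) (Or.inr (by rw [pt_apply_zero, pt_apply_zero]; norm_num))
            · rw [vb4, show n + 3 + 1 = n + 4 by omega, vb5 _ le_rfl]
              exact adj_of_up (by rw [pt_apply_zero, pt_apply_zero]) (by rw [pt_apply_one, pt_apply_one]; ring) (by rw [pt_apply_zero, pt_apply_one]; omega)
        · intro i hi j hj hij
          simp only [Set.mem_setOf_eq] at hi hj
          have e0 := congrFun hij 0
          have e1 := congrFun hij 1
          rcases prof i hi with ⟨ai, av⟩ | ⟨ai, a0, a1⟩ | ⟨ai, a0, a1⟩ | ⟨ai, a0, a1⟩ | ⟨ai, a0, a1⟩ <;>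
            rcases prof j hj with ⟨bi, bv⟩ | ⟨bi, b0, b1⟩ | ⟨bi, b0, b1⟩ | ⟨bi, b0, b1⟩ | ⟨bi, b0, b1⟩
          · rw [av, bv] at hij; exact hinj (show i ∈ {i | i ≤ n} by simp; omega) (show j ∈ {i | i ≤ n} by simp; omega) hij
          · exfalso; rw [av, b0] at e0; rw [av, b1] at e1; exact hfree i ai ⟨e0, e1⟩
          · exfalso; rw [av, b1] at e1; have := htop i ai; omega
          · exfalso; rw [av, b1] at e1; have := htop i ai; omega
          · exfalso; rw [av, b1] at e1; have := htop i ai; omega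
          · exfalso; rw [a0, bv] at e0; rw [a1, bv] at e1; exact hfree j bi ⟨e0.symm, e1.symm⟩
          · omega
          · exfalso; rw [a1, b1] at e1; omega
          · exfalso; rw [a1, b1] at e1; omega
          · exfalso; rw [a1, b1] at e1; omega
          · exfalso; rw [a1, bv] at e1; have := htop j bi; omega
          · exfalso; rw [a1, b1] at e1; omega
          · omega
          · exfalso; rw [a0, b0] at e0; omega
          · exfalso; rw [a1, b1] at e1; omega
          · exfalso; rw [a1, bv] at e1; have := htop j bi; omega
          · exfalso; rw [a1, b1] at e1; omega
          · exfalso; rw [a0, b0] at e0; omega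
          · omega
          · exfalso; rw [a1, b1] at e1; omega
          · exfalso; rw [a1, bv] at e1; have := htop j bi; omega
          · exfalso; rw [a1, b1] at e1; omega
          · exfalso; rw [a1, b1] at e1; omega
          · exfalso; rw [a1, b1] at e1; omega
          · omega
        · rcases prof i hi with ⟨ai, av⟩ | ⟨ai, a0, -⟩ | ⟨ai, a0, -⟩ | ⟨ai, a0, -⟩ | ⟨ai, a0, -⟩
          · rw [av]; exact hH i ai
          all_goals (rw [a0]; try decide)
      refine ⟨⟨hmem, by change vB n ω (n + 4) 0 = 0; rw [vb5 _ le_rfl, pt_apply_zero], fun i hi => ?_, ?_⟩,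
        by change n + 1 ≤ n + 4; omega, by change n + 4 ≤ n + 4; omega, ?_, ?_, fun hb i hi1 hi => ?_⟩
      · change vB n ω i 1 < vB n ω (n + 4) 1
        change i < n + 4 at hi
        rw [vb5 _ le_rfl, pt_apply_one]
        rcases prof i (by omega) with ⟨ai, av⟩ | ⟨ai, a0, a1⟩ | ⟨ai, a0, a1⟩ | ⟨ai, a0, a1⟩ | ⟨ai, a0, a1⟩
        · rw [av]; have := htop i ai; omega
        all_goals omega
      · change vB n ω (n + 4) 1 % 2 = 1
        rw [vb5 _ le_rfl, pt_apply_one]; omega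
      · change visits n ω ≤ visits (n + 4) (vB n ω)
        have := visits_mono (show n ≤ n + 4 by omega) (vB n ω)
        rw [visits_congr (ω := vB n ω) (ξ := ω) (fun i hi => by rw [vb1 i hi])] at this; exact this
      · change visits (n + 4) (vB n ω) ≤ visits n ω + 2
        rw [show n + 4 = n + 1 + 1 + 1 + 1 by ring, visits_succ, visits_succ, visits_succ, visits_succ,
          visits_congr (ω := vB n ω) (ξ := ω) (fun i hi => by rw [vb1 i hi]), show n + 1 + 1 = n + 2 by ring, show n + 2 + 1 = n + 3 by ring,
          show n + 3 + 1 = n + 4 by ring, vb2, vb3, vb4, vb5 _ le_rfl]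
        simp only [pt_apply_zero]
        norm_num
      · change 1 ≤ vB n ω i 1
        change i ≤ n + 4 at hi
        have h1 : 1 ≤ ω n 1 := by omega
        rcases prof i hi with ⟨ai, av⟩ | ⟨ai, a0, a1⟩ | ⟨ai, a0, a1⟩ | ⟨ai, a0, a1⟩ | ⟨ai, a0, a1⟩
        · rw [av]; exact hb i hi1 ai
        all_goals rw [a1]; omega
    · -- case c
      have hv : vst (n, ω) = (n + 2, vC n ω) := by unfold vst; rw [if_neg ha, if_neg hb0]
      rw [hv]
      have hp1 : ω (n - 1) 0 = 1 ∧ ω (n - 1) 1 = ω n 1 := by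
        rcases hpred with ⟨h, -⟩ | h
        · exact absurd h hb0
        · exact h
      have vc1 : ∀ i < n, vC n ω i = ω i := fun i hi => by unfold vC; rw [if_pos hi]
      have vc2 : vC n ω n = pt 1 (ω n 1 + 1) := by unfold vC; rw [if_neg (lt_irrefl _), if_pos rfl]
      have vc3 : vC n ω (n + 1) = pt 0 (ω n 1 + 1) := by unfold vC; rw [if_neg (by omega), if_neg (by omega), if_pos rfl]
      have vc4 : ∀ i, n + 2 ≤ i → vC n ω i = pt 0 (ω n 1 + 2) := fun i hi => by
        unfold vC; rw [if_neg (by omega), if_neg (by omega), if_neg (by omega)]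
      have prof : ∀ i ≤ n + 2, (i < n ∧ vC n ω i = ω i) ∨ (i = n ∧ vC n ω i 0 = 1 ∧ vC n ω i 1 = ω n 1 + 1) ∨
          (i = n + 1 ∧ vC n ω i 0 = 0 ∧ vC n ω i 1 = ω n 1 + 1) ∨ (i = n + 2 ∧ vC n ω i 0 = 0 ∧ vC n ω i 1 = ω n 1 + 2) := by
        intro i hi
        rcases Nat.lt_or_ge i n with h1 | h1
        · exact Or.inl ⟨h1, vc1 i h1⟩
        · have hc : i = n ∨ i = n + 1 ∨ i = n + 2 := by omega
          rcases hc with rfl | rfl | rfl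
          · right; left; exact ⟨rfl, by rw [vc2, pt_apply_zero], by rw [vc2, pt_apply_one]⟩
          · right; right; left; exact ⟨rfl, by rw [vc3, pt_apply_zero], by rw [vc3, pt_apply_one]⟩
          · right; right; right; exact ⟨rfl, by rw [vc4 _ le_rfl, pt_apply_zero], by rw [vc4 _ le_rfl, pt_apply_one]⟩
      have hmem : vC n ω ∈ hp (n + 2) := by
        refine mem_hp.2 ⟨mem_saws_iff.2 ⟨by rw [vc1 0 (by omega), h0], fun i hi => by rw [vc4 i hi, vc4 (n + 2) le_rfl],
          fun i hi => ?_, ?_⟩, fun i hi => ?_⟩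
        · rcases Nat.lt_or_ge (i + 1) n with h1 | h1
          · rw [vc1 i (by omega), vc1 (i + 1) h1]; exact hbw i (by omega)
          · have hc : i + 1 = n ∨ i = n ∨ i = n + 1 := by omega
            rcases hc with hc | rfl | rfl
            · have hi' : i = n - 1 := by omega
              rw [vc1 i (by omega), hc, vc2, hi']
              exact adj_of_up (by rw [pt_apply_zero, hp1.1]) (by rw [pt_apply_one, hp1.2]) (by rw [hp1.1, hp1.2]; omega)
            · rw [vc2, vc3]; exact adj_of_horiz (by rw [pt_apply_one, pt_apply_one]) (Or.inr (by rw [pt_apply_zero, pt_apply_zero]; norm_num))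
            · rw [vc3, show n + 1 + 1 = n + 2 by omega, vc4 _ le_rfl]
              exact adj_of_up (by rw [pt_apply_zero, pt_apply_zero]) (by rw [pt_apply_one, pt_apply_one]; ring) (by rw [pt_apply_zero, pt_apply_one]; omega)
        · intro i hi j hj hij
          simp only [Set.mem_setOf_eq] at hi hj
          have e0 := congrFun hij 0
          have e1 := congrFun hij 1
          rcases prof i hi with ⟨ai, av⟩ | ⟨ai, a0, a1⟩ | ⟨ai, a0, a1⟩ | ⟨ai, a0, a1⟩ <;>
            rcases prof j hj with ⟨bi, bv⟩ | ⟨bi, b0, b1⟩ | ⟨bi, b0, b1⟩ | ⟨bi, b0, b1⟩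
          · rw [av, bv] at hij; exact hinj (show i ∈ {i | i ≤ n} by simp; omega) (show j ∈ {i | i ≤ n} by simp; omega) hij
          · exfalso; rw [av, b1] at e1; have := htop i ai.le; omega
          · exfalso; rw [av, b1] at e1; have := htop i ai.le; omega
          · exfalso; rw [av, b1] at e1; have := htop i ai.le; omega
          · exfalso; rw [a1, bv] at e1; have := htop j bi.le; omega
          · omega
          · exfalso; rw [a0, b0] at e0; omega
          · exfalso; rw [a1, b1] at e1; omega
          · exfalso; rw [a1, bv] at e1; have := htop j bi.le; omega
          · exfalso; rw [a0, b0] at e0; omega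
          · omega
          · exfalso; rw [a1, b1] at e1; omega
          · exfalso; rw [a1, bv] at e1; have := htop j bi.le; omega
          · exfalso; rw [a1, b1] at e1; omega
          · exfalso; rw [a1, b1] at e1; omega
          · omega
        · rcases prof i hi with ⟨ai, av⟩ | ⟨ai, a0, -⟩ | ⟨ai, a0, -⟩ | ⟨ai, a0, -⟩
          · rw [av]; exact hH i ai.le
          all_goals (rw [a0]; try decide)
      refine ⟨⟨hmem, by change vC n ω (n + 2) 0 = 0; rw [vc4 _ le_rfl, pt_apply_zero], fun i hi => ?_, ?_⟩,
        by change n + 1 ≤ n + 2; omega, by change n + 2 ≤ n + 4; omega, ?_, ?_, fun hb i hi1 hi => ?_⟩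
      · change vC n ω i 1 < vC n ω (n + 2) 1
        change i < n + 2 at hi
        rw [vc4 _ le_rfl, pt_apply_one]
        rcases prof i (by omega) with ⟨ai, av⟩ | ⟨ai, a0, a1⟩ | ⟨ai, a0, a1⟩ | ⟨ai, a0, a1⟩
        · rw [av]; have := htop i ai.le; omega
        all_goals omega
      · change vC n ω (n + 2) 1 % 2 = 1
        rw [vc4 _ le_rfl, pt_apply_one]; omega
      · change visits n ω ≤ visits (n + 2) (vC n ω)
        obtain ⟨m, rfl⟩ : ∃ m, n = m + 1 := ⟨n - 1, by omega⟩
        have e1 : visits m (vC (m + 1) ω) = visits m ω := visits_congr fun i hi => by rw [vc1 i (by omega)]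
        rw [show m + 1 + 2 = m + 1 + 1 + 1 by ring, visits_succ, visits_succ, visits_succ, visits_succ, e1,
          show m + 1 + 1 = m + 2 by ring, vc2]
        rw [show m + 1 + 1 = m + 2 by ring] at vc3
        rw [vc3, show m + 2 + 1 = m + 1 + 2 by ring, vc4 _ le_rfl]
        simp only [pt_apply_zero]
        split_ifs <;> omega
      · change visits (n + 2) (vC n ω) ≤ visits n ω + 2
        obtain ⟨m, rfl⟩ : ∃ m, n = m + 1 := ⟨n - 1, by omega⟩
        have e1 : visits m (vC (m + 1) ω) = visits m ω := visits_congr fun i hi => by rw [vc1 i (by omega)]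
        rw [show m + 1 + 2 = m + 1 + 1 + 1 by ring, visits_succ, visits_succ, visits_succ, visits_succ, e1,
          show m + 1 + 1 = m + 2 by ring, vc2]
        rw [show m + 1 + 1 = m + 2 by ring] at vc3
        rw [vc3, show m + 2 + 1 = m + 1 + 2 by ring, vc4 _ le_rfl]
        simp only [pt_apply_zero]
        split_ifs <;> omega
      · change 1 ≤ vC n ω i 1
        change i ≤ n + 2 at hi
        have h1 : 1 ≤ ω n 1 := by omega
        rcases prof i hi with ⟨ai, av⟩ | ⟨ai, a0, a1⟩ | ⟨ai, a0, a1⟩ | ⟨ai, a0, a1⟩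
        · rw [av]; exact hb i hi1 ai.le
        all_goals rw [a1]; omega

/-- **`V` is injective given its case** (on top-unfolded arch states). [cite: Beaton2014RotatedHoneycomb, §3.1, proof of Proposition 7 (arXiv v3 pp. 12–13)] -/
theorem vst_inj {τ : St} (hτ : TopArch τ) (hc : vcase σ = vcase τ) (he : vst σ = vst τ) : σ = τ := by
  obtain ⟨n, ω⟩ := σ
  obtain ⟨m, ξ⟩ := τ
  obtain ⟨hg, hend, htop⟩ := hσ
  obtain ⟨hg', hend', htop'⟩ := hτ
  change ω ∈ hp n at hg; change ξ ∈ hp m at hg'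
  obtain ⟨h0, hfr, -, -⟩ := mem_saws_iff.1 (mem_hp.1 hg).1
  obtain ⟨h0', hfr', -, -⟩ := mem_saws_iff.1 (mem_hp.1 hg').1
  change ω n 0 = 0 at hend; change ξ m 0 = 0 at hend'
  unfold vcase at hc; unfold vst at he
  simp only at hc he
  by_cases ha : (ω n 0 + ω n 1) % 2 = 0 <;> by_cases ha' : (ξ m 0 + ξ m 1) % 2 = 0
  · rw [if_pos ha, if_pos ha'] at he
    simp only [Prod.mk.injEq] at he
    obtain ⟨hnm, hω⟩ := he
    have hnm' : n = m := by omega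
    subst hnm'
    refine Prod.ext rfl (funext fun i => ?_)
    change ω i = ξ i
    rcases le_or_gt i n with hi | hi
    · have e := congrFun hω i; unfold vA at e; rw [if_pos hi, if_pos hi] at e; exact e
    · have e := congrFun hω n; unfold vA at e; rw [if_pos le_rfl, if_pos le_rfl] at e
      rw [hfr i hi.le, hfr' i hi.le, e]
  · rw [if_pos ha, if_neg ha'] at hc; split_ifs at hc
  · rw [if_neg ha, if_pos ha'] at hc; split_ifs at hc
  · rw [if_neg ha, if_neg ha'] at he hc
    by_cases hb : ω (n - 1) 0 = 0 <;> by_cases hb' : ξ (m - 1) 0 = 0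
    · rw [if_pos hb, if_pos hb'] at he
      simp only [Prod.mk.injEq] at he
      obtain ⟨hnm, hω⟩ := he
      have hnm' : n = m := by omega
      subst hnm'
      refine Prod.ext rfl (funext fun i => ?_)
      change ω i = ξ i
      rcases le_or_gt i n with hi | hi
      · have e := congrFun hω i; unfold vB at e; rw [if_pos hi, if_pos hi] at e; exact e
      · have e := congrFun hω n; unfold vB at e; rw [if_pos le_rfl, if_pos le_rfl] at e
        rw [hfr i hi.le, hfr' i hi.le, e]
    · rw [if_pos hb, if_neg hb'] at hc; exact absurd hc (by norm_num)
    · rw [if_neg hb, if_pos hb'] at hc; exact absurd hc (by norm_num)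
    · rw [if_neg hb, if_neg hb'] at he
      simp only [Prod.mk.injEq] at he
      obtain ⟨hnm, hω⟩ := he
      have hnm' : n = m := by omega
      subst hnm'
      have hn : 1 ≤ n := by
        by_contra h; have : n = 0 := by omega
        subst this; rw [h0] at ha; exact ha (by decide)
      -- values before `n` agree; the endpoint `(0, M)` is recovered from the new end level `M + 2`
      have hM : ω n 1 = ξ n 1 := by
        have e := congrFun (congrFun hω (n + 2)) 1
        unfold vC at e
        rw [if_neg (by omega), if_neg (by omega), if_neg (by omega), if_neg (by omega), if_neg (by omega), if_neg (by omega),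
          pt_apply_one, pt_apply_one] at e
        omega
      refine Prod.ext rfl (funext fun i => ?_)
      change ω i = ξ i
      rcases Nat.lt_or_ge i n with hi | hi
      · have e := congrFun hω i; unfold vC at e; rw [if_pos hi, if_pos hi] at e; exact e
      · rw [hfr i hi, hfr' i hi, site_two_eq_iff, hend, hend', hM]; exact ⟨rfl, rfl⟩

end V

/-- The case tag is `≤ 2`. [cite: Beaton2014RotatedHoneycomb, §3.1, proof of Proposition 7 (arXiv v3 pp. 12–13: the fixed-length unfolding)] -/
theorem vcase_le (σ : St) : vcase σ ≤ 2 := by unfold vcase; split_ifs <;> omega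

/-! ### The flip–reversal `R`: read a strictly top-unfolded arch backwards in the mirror `Y ↦ M − Y` -/

/-- **`R(ω)_i = S_M(ω_{n−i})`** (`M` = the odd end level): an automorphism image read backwards, again a `C`-class arch from `0`, with the
same visits, STRICT BOTTOM, and the old start as new endpoint `(0, M)`.
[cite: HammersleyTorrieWhittington1982, §2 (unfolding the second end by symmetry); Beaton2014RotatedHoneycomb, §3.2 (arXiv v3 p. 15: "By the symmetry of bridges")] -/
def rst (σ : St) : St := (σ.1, fun i => flipY (σ.2 σ.1 1) (σ.2 (σ.1 - i)))

/-- **`R` on a strictly top-unfolded arch with odd end level**: a good arch of the same length, same endpoint level, same visits, strict bottom.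
[cite: HammersleyTorrieWhittington1982, §2; Beaton2014RotatedHoneycomb, §3.2 (arXiv v3 p. 15)] -/
theorem rst_spec {σ : St} (hσ : StrictTopArch σ) :
    Good (rst σ) ∧ (rst σ).1 = σ.1 ∧ (rst σ).2 (rst σ).1 0 = 0 ∧ (rst σ).2 (rst σ).1 1 = σ.2 σ.1 1 ∧
      visits (rst σ).1 (rst σ).2 = visits σ.1 σ.2 ∧ (∀ i, 1 ≤ i → i ≤ (rst σ).1 → 1 ≤ (rst σ).2 i 1) := by
  obtain ⟨n, ω⟩ := σ
  obtain ⟨hg, hend, htop, hodd⟩ := hσ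
  change ω ∈ hp n at hg; change ω n 0 = 0 at hend; change ∀ i < n, ω i 1 < ω n 1 at htop; change ω n 1 % 2 = 1 at hodd
  obtain ⟨hs, hH⟩ := mem_hp.1 hg
  obtain ⟨h0, hfr, hbw, hinj⟩ := mem_saws_iff.1 hs
  have hval : ∀ i, (rst (n, ω)).2 i = flipY (ω n 1) (ω (n - i)) := fun i => rfl
  have hlen : (rst (n, ω)).1 = n := rfl
  simp only [hlen]
  have hmem : (rst (n, ω)).2 ∈ hp n := by
    refine mem_hp.2 ⟨mem_saws_iff.2 ⟨?_, fun i hi => ?_, fun i hi => ?_, ?_⟩, fun i hi => ?_⟩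
    · rw [hval, Nat.sub_zero, site_two_eq_iff, flipY_apply_zero, flipY_apply_one, hend]; exact ⟨rfl, by simp⟩
    · rw [hval, hval, Nat.sub_eq_zero_of_le hi, Nat.sub_self]
    · rw [hval, hval, adj_flipY_iff hodd]
      have := hbw (n - (i + 1)) (by omega)
      rw [show n - (i + 1) + 1 = n - i by omega] at this
      exact this.symm
    · intro i hi j hj hij
      simp only [Set.mem_setOf_eq] at hi hj
      rw [hval, hval] at hij
      have := hinj (show n - i ∈ {i | i ≤ n} by simp) (show n - j ∈ {i | i ≤ n} by simp) (flipY_injective _ hij)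
      omega
    · rw [hval, flipY_apply_zero]; exact hH (n - i) (by omega)
  refine ⟨hmem, trivial, by rw [hval, Nat.sub_self, flipY_apply_zero, h0]; rfl,
    by rw [hval, Nat.sub_self, flipY_apply_one, h0]; change ω n 1 - 0 = ω n 1; ring, ?_, fun i hi1 hi => ?_⟩
  · -- visits: the time reversal `i ↦ n - i` is a bijection of the visit times
    rw [visits_eq_card, visits_eq_card]
    refine Finset.card_nbij (fun i => n - i) (fun i hi => ?_) (fun i hi j hj hij => ?_) (fun k hk => ?_)
    · rw [Finset.mem_coe, Finset.mem_filter, Finset.mem_range] at hi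
      rw [hval, flipY_apply_zero] at hi
      exact Finset.mem_filter.2 ⟨Finset.mem_range.2 (by change n - i < n + 1; omega), hi.2⟩
    · rw [Finset.mem_coe, Finset.mem_filter, Finset.mem_range] at hi hj
      change n - i = n - j at hij; omega
    · rw [Finset.mem_coe, Finset.mem_filter, Finset.mem_range] at hk
      refine ⟨n - k, ?_, by change n - (n - k) = k; omega⟩
      rw [Finset.mem_coe, Finset.mem_filter, Finset.mem_range, hval, flipY_apply_zero, show n - (n - k) = k by omega]
      exact ⟨by omega, hk.2⟩
  · rw [hval, flipY_apply_one]
    have := htop (n - i) (by omega)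
    omega

/-- **`R` is injective** on strictly top-unfolded arch states. [cite: Beaton2014RotatedHoneycomb, §3.1, proof of Proposition 7 (arXiv v3 pp. 12–13: the fixed-length unfolding)] -/
theorem rst_inj {σ τ : St} (hσ : StrictTopArch σ) (hτ : StrictTopArch τ) (he : rst σ = rst τ) : σ = τ := by
  obtain ⟨n, ω⟩ := σ
  obtain ⟨m, ξ⟩ := τ
  obtain ⟨hg, -, -, -⟩ := hσ
  obtain ⟨hg', -, -, -⟩ := hτ
  change ω ∈ hp n at hg; change ξ ∈ hp m at hg'
  obtain ⟨h0, hfr, -, -⟩ := mem_saws_iff.1 (mem_hp.1 hg).1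
  obtain ⟨h0', hfr', -, -⟩ := mem_saws_iff.1 (mem_hp.1 hg').1
  unfold rst at he
  simp only [Prod.mk.injEq] at he
  obtain ⟨rfl, hω⟩ := he
  have hM : ω n 1 = ξ n 1 := by
    have e := congrFun (congrFun hω n) 1
    rw [Nat.sub_self, h0, h0', flipY_apply_one, flipY_apply_one] at e
    change ω n 1 - 0 = ξ n 1 - 0 at e; omega
  refine Prod.ext rfl (funext fun i => ?_)
  change ω i = ξ i
  rcases le_or_gt i n with hi | hi
  · have e := congrFun hω (n - i)
    rw [show n - (n - i) = i by omega, hM] at e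
    exact flipY_injective _ e
  · have e := congrFun hω 0
    rw [Nat.sub_zero, hM] at e
    rw [hfr i hi.le, hfr' i hi.le]; exact flipY_injective _ e


/-! ### Weighted fibre counting: `Σ_S y^{v} ≤ (B+1) max(1,1/y)^c Σ_{F(S)} y^{v}` -/

/-- Weights move by a bounded amount: `y^a ≤ max(1, 1/y)^c · y^b` when `a ≤ b ≤ a + c`. [cite: MadrasSlade1993, §3.1 (proof of Proposition 3.1.5: A₁(ω), n₁(ω), the unfolded walk ω')] -/
theorem pow_le_max_mul_pow (hy : 0 < y) {a b c : ℕ} (h1 : a ≤ b) (h2 : b ≤ a + c) : y ^ a ≤ max 1 y⁻¹ ^ c * y ^ b := by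
  have hK : 1 ≤ max 1 y⁻¹ ^ c := one_le_pow₀ (le_max_left _ _)
  rcases le_or_gt 1 y with hy1 | hy1
  · calc y ^ a ≤ y ^ b := pow_le_pow_right₀ hy1 h1
      _ = 1 * y ^ b := (one_mul _).symm
      _ ≤ max 1 y⁻¹ ^ c * y ^ b := mul_le_mul_of_nonneg_right hK (pow_nonneg hy.le _)
  · have h3 : y ^ a * y ^ c ≤ y ^ b := by
      rw [← pow_add]; exact pow_le_pow_of_le_one hy.le hy1.le h2
    have hyc : 0 < y ^ c := pow_pos hy c
    calc y ^ a = y ^ a * y ^ c * (y⁻¹) ^ c := by rw [inv_pow, mul_assoc, mul_inv_cancel₀ hyc.ne', mul_one]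
      _ ≤ y ^ b * (y⁻¹) ^ c := mul_le_mul_of_nonneg_right h3 (pow_nonneg (inv_nonneg.2 hy.le) _)
      _ ≤ y ^ b * max 1 y⁻¹ ^ c := mul_le_mul_of_nonneg_left (pow_le_pow_left₀ (inv_nonneg.2 hy.le) (le_max_right _ _) _) (pow_nonneg hy.le _)
      _ = max 1 y⁻¹ ^ c * y ^ b := mul_comm _ _

/-- **Weighted fibre lemma**: if `F` is injective on the level sets of a label `ℓ ≤ B` and moves the weight exponent up by at most `c`,
then `Σ_{a ∈ S} y^{v a} ≤ (B+1) max(1,1/y)^c Σ_{b ∈ F(S)} y^{v' b}`.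
[cite: MadrasSlade1993, §3.1 (proof of Proposition 3.1.5: "this transformation is one-to-one", and (3.1.4) h_N ≤ Σ_A P_D(A) b_{N,A})] -/
theorem sum_pow_le_of_fibre {α β : Type*} [DecidableEq β] (S : Finset α) (F : α → β) (ℓ : α → ℕ) (v : α → ℕ) (v' : β → ℕ) (B c : ℕ)
    (hy : 0 < y) (hℓ : ∀ a ∈ S, ℓ a ≤ B) (hinj : ∀ a₁ ∈ S, ∀ a₂ ∈ S, ℓ a₁ = ℓ a₂ → F a₁ = F a₂ → a₁ = a₂)
    (hv : ∀ a ∈ S, v a ≤ v' (F a) ∧ v' (F a) ≤ v a + c) :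
    ∑ a ∈ S, y ^ v a ≤ ((B + 1) * max 1 y⁻¹ ^ c) * ∑ b ∈ S.image F, y ^ v' b := by
  rw [← Finset.sum_fiberwise_of_maps_to (s := S) (t := S.image F) (g := F) (fun a ha => Finset.mem_image_of_mem F ha),
    Finset.mul_sum]
  refine Finset.sum_le_sum fun b hb => ?_
  have hcard : #(S.filter fun a => F a = b) ≤ B + 1 := by
    calc #(S.filter fun a => F a = b) ≤ #(range (B + 1)) :=
          Finset.card_le_card_of_injOn ℓ (fun a ha => ?_) (fun a₁ h₁ a₂ h₂ h => ?_)
      _ = B + 1 := Finset.card_range _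
    · rw [Finset.mem_coe, Finset.mem_filter] at ha
      exact Finset.mem_coe.2 (Finset.mem_range.2 (Nat.lt_succ_of_le (hℓ a ha.1)))
    · rw [Finset.mem_coe, Finset.mem_filter] at h₁ h₂
      exact hinj a₁ h₁.1 a₂ h₂.1 h (h₁.2.trans h₂.2.symm)
  have hterm : ∀ a ∈ S.filter (fun a => F a = b), y ^ v a ≤ max 1 y⁻¹ ^ c * y ^ v' b := by
    intro a ha
    rw [Finset.mem_filter] at ha
    obtain ⟨ha, rfl⟩ := ha
    exact pow_le_max_mul_pow hy (hv a ha).1 (hv a ha).2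
  calc ∑ a ∈ S.filter (fun a => F a = b), y ^ v a ≤ #(S.filter fun a => F a = b) • (max 1 y⁻¹ ^ c * y ^ v' b) :=
        Finset.sum_le_card_nsmul _ _ _ hterm
    _ = #(S.filter fun a => F a = b) * (max 1 y⁻¹ ^ c * y ^ v' b) := nsmul_eq_mul _ _
    _ ≤ (B + 1 : ℝ) * (max 1 y⁻¹ ^ c * y ^ v' b) := by
        refine mul_le_mul_of_nonneg_right (by exact_mod_cast hcard) ?_
        exact mul_nonneg (pow_nonneg (zero_le_one.trans (le_max_left _ _)) _) (pow_nonneg hy.le _)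
    _ = (B + 1) * max 1 y⁻¹ ^ c * y ^ v' b := by ring

/-- The weight of a state. [cite: Beaton2014RotatedHoneycomb, §3.1 (arXiv v3 p. 11: "occupying m vertices in the surface")] -/
def vis (σ : St) : ℕ := visits σ.1 σ.2

/-- **Fibre counting along `k` unfolding steps**: on good states of length `≤ L`,
`Σ_S y^{vis} ≤ ((L + 3k + 1) max(1,1/y)²)^k Σ_{ust^k(S)} y^{vis}`. [cite: MadrasSlade1993, §3.1 (proof of Proposition 3.1.5); Beaton2014RotatedHoneycomb, §3.1 (arXiv v3 p. 12: "at most e^{c√n}")] -/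
theorem sum_iterate_le (hy : 0 < y) (k : ℕ) : ∀ (S : Finset St) (L : ℕ), (∀ σ ∈ S, Good σ ∧ σ.1 ≤ L) →
    ∑ σ ∈ S, y ^ vis σ ≤ (((L : ℝ) + 3 * k + 1) * max 1 y⁻¹ ^ 2) ^ k * ∑ τ ∈ S.image (ust^[k]), y ^ vis τ := by
  induction k with
  | zero =>
    intro S L _
    simp only [Function.iterate_zero, Finset.image_id, pow_zero, one_mul, Nat.cast_zero, mul_zero, add_zero, le_refl]
  | succ k ih =>
    intro S L hS
    have hK : (0 : ℝ) ≤ max 1 y⁻¹ ^ 2 := pow_nonneg (zero_le_one.trans (le_max_left _ _)) _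
    -- one step with the label `maxY` (an integer in `[0, L]`)
    have h1 := sum_pow_le_of_fibre S ust (fun σ => (maxY σ.1 σ.2).toNat) vis vis L 2 hy
      (fun σ hσ => by
        obtain ⟨hg, hl⟩ := hS σ hσ
        have hb := maxY_bounds (mem_hp.1 hg).1
        have : (maxY σ.1 σ.2).toNat ≤ σ.1 := by
          have := Int.toNat_of_nonneg hb.1; omega
        exact this.trans hl)
      (fun σ₁ h₁ σ₂ h₂ hℓ he => by
        obtain ⟨hg₁, -⟩ := hS σ₁ h₁
        obtain ⟨hg₂, -⟩ := hS σ₂ h₂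
        have hb₁ := (maxY_bounds (mem_hp.1 hg₁).1).1
        have hb₂ := (maxY_bounds (mem_hp.1 hg₂).1).1
        have hM : maxY σ₁.1 σ₁.2 = maxY σ₂.1 σ₂.2 := by
          have e₁ := Int.toNat_of_nonneg hb₁; have e₂ := Int.toNat_of_nonneg hb₂; omega
        exact ust_injOn_level hg₁ hg₂ hM he)
      (fun σ hσ => by
        obtain ⟨-, -, -, -, hv1, hv2, -⟩ := ust_spec (hS σ hσ).1
        exact ⟨hv1, hv2⟩)
    -- the image: good states of length `≤ L + 3`
    have hS' : ∀ τ ∈ S.image ust, Good τ ∧ τ.1 ≤ L + 3 := by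
      intro τ hτ
      obtain ⟨σ, hσ, rfl⟩ := Finset.mem_image.1 hτ
      obtain ⟨hg', -, hl', -⟩ := ust_spec (hS σ hσ).1
      exact ⟨hg', hl'.trans (by linarith [(hS σ hσ).2])⟩
    have h2 := ih (S.image ust) (L + 3) hS'
    rw [Finset.image_image, show ust^[k] ∘ ust = ust^[k + 1] from (Function.iterate_succ ust k).symm] at h2
    have hmono : ((L : ℝ) + 1) * max 1 y⁻¹ ^ 2 ≤ ((L : ℝ) + 3 * (k + 1 : ℕ) + 1) * max 1 y⁻¹ ^ 2 :=
      mul_le_mul_of_nonneg_right (by push_cast; linarith) hK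
    have hmono' : (((L + 3 : ℕ) : ℝ) + 3 * k + 1) * max 1 y⁻¹ ^ 2 ≤ ((L : ℝ) + 3 * (k + 1 : ℕ) + 1) * max 1 y⁻¹ ^ 2 :=
      mul_le_mul_of_nonneg_right (by push_cast; linarith) hK
    have hnn : 0 ≤ ∑ τ ∈ S.image (ust^[k + 1]), y ^ vis τ := Finset.sum_nonneg fun _ _ => pow_nonneg hy.le _
    have hA0 : (0 : ℝ) ≤ ((L : ℝ) + 1) * max 1 y⁻¹ ^ 2 := mul_nonneg (by positivity) hK
    have hB0 : (0 : ℝ) ≤ (((L + 3 : ℕ) : ℝ) + 3 * k + 1) * max 1 y⁻¹ ^ 2 := mul_nonneg (by positivity) hK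
    calc ∑ σ ∈ S, y ^ vis σ ≤ ((L : ℝ) + 1) * max 1 y⁻¹ ^ 2 * ∑ τ ∈ S.image ust, y ^ vis τ := by exact_mod_cast h1
      _ ≤ ((L : ℝ) + 1) * max 1 y⁻¹ ^ 2 * (((((L + 3 : ℕ) : ℝ) + 3 * k + 1) * max 1 y⁻¹ ^ 2) ^ k * ∑ τ ∈ S.image (ust^[k + 1]), y ^ vis τ) :=
          mul_le_mul_of_nonneg_left h2 hA0
      _ ≤ (((L : ℝ) + 3 * (k + 1 : ℕ) + 1) * max 1 y⁻¹ ^ 2) *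
            ((((L : ℝ) + 3 * (k + 1 : ℕ) + 1) * max 1 y⁻¹ ^ 2) ^ k * ∑ τ ∈ S.image (ust^[k + 1]), y ^ vis τ) := by
          refine mul_le_mul hmono (mul_le_mul_of_nonneg_right (pow_le_pow_left₀ hB0 hmono' k) hnn) ?_ (hA0.trans hmono)
          exact mul_nonneg (pow_nonneg hB0 _) hnn
      _ = (((L : ℝ) + 3 * (k + 1 : ℕ) + 1) * max 1 y⁻¹ ^ 2) ^ (k + 1) * ∑ τ ∈ S.image (ust^[k + 1]), y ^ vis τ := by
          rw [pow_succ]; ring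


/-! ### The chain: arches → (unfold) → (strictify) → (reverse) → (unfold) → (strictify) = armchair wall bridges -/

/-- A strictly top-unfolded arch with a strict bottom is an armchair wall bridge. [cite: HammersleyTorrieWhittington1982, §2 (unfolded walks)] -/
theorem mem_wb_of_state {σ : St} (h : StrictTopArch σ) (hb : ∀ i, 1 ≤ i → i ≤ σ.1 → 1 ≤ σ.2 i 1) (h1 : 1 ≤ σ.1) : σ.2 ∈ wb σ.1 := by
  obtain ⟨hg, hend, htop, -⟩ := h
  refine mem_wb.2 ⟨mem_arches.2 ⟨hg, hend⟩, ?_, fun i hi1 hi => ⟨?_, htop i hi⟩⟩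
  · have := hb σ.1 h1 le_rfl; omega
  · have := hb i hi1 hi.le; omega

/-- The arch states of length `n`. [cite: Beaton2014RotatedHoneycomb, §3.1, proof of Proposition 7 (arXiv v3 pp. 12–13: the fixed-length unfolding)] -/
def archSt (n : ℕ) : Finset St := (arches n).image fun ω => ((n, ω) : St)

/-- `A_n(y)` as a sum over arch states. [cite: Beaton2014RotatedHoneycomb, §3.1, proof of Proposition 7 (arXiv v3 pp. 12–13: the fixed-length unfolding)] -/
theorem Aw_eq_sum_archSt (n : ℕ) (y : ℝ) : Aw n y = ∑ σ ∈ archSt n, y ^ vis σ := by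
  rw [archSt, Finset.sum_image (fun ω _ ω' _ h => (Prod.mk.inj h).2)]
  rfl

/-- Number of unfolding steps for length `n`: `K₁(n) = ⌊√(2n)⌋ + 2`, so that `K₁ (K₁ − 1) > 2n`. [cite: MadrasSlade1993, §3.1 (proof of Proposition 3.1.5, the distinct increments; Beaton2014RotatedHoneycomb p. 12: ⌊(−1+√(1+8n))/2⌋)] -/
def K1 (n : ℕ) : ℕ := Nat.sqrt (2 * n) + 2

/-- `2n < K₁ (K₁ − 1)`. [cite: MadrasSlade1993, §3.1 (proof of Proposition 3.1.5: A₁(ω), n₁(ω), the unfolded walk ω')] -/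
theorem two_mul_lt_K1 (n : ℕ) : 2 * n < K1 n * (K1 n - 1) := by
  have h := Nat.lt_succ_sqrt' (2 * n)
  rw [K1, show Nat.sqrt (2 * n) + 2 - 1 = Nat.sqrt (2 * n) + 1 by omega]
  nlinarith

/-- `K₁` is monotone. [cite: MadrasSlade1993, §3.1 (proof of Proposition 3.1.5: A₁(ω), n₁(ω), the unfolded walk ω')] -/
theorem K1_mono {a b : ℕ} (h : a ≤ b) : K1 a ≤ K1 b := by
  unfold K1; have := Nat.sqrt_le_sqrt (show 2 * a ≤ 2 * b by omega); omega

/-- The length bound after the first unfolding and strictification: `L₃ = n + 3K₁ + 4`. [cite: MadrasSlade1993, §3.1 (proof of Proposition 3.1.5: A₁(ω), n₁(ω), the unfolded walk ω')] -/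
def L3 (n : ℕ) : ℕ := n + 3 * K1 n + 4

/-- The length bound at the end: `L₅ = L₃ + 3K₁(L₃) + 4`. [cite: MadrasSlade1993, §3.1 (proof of Proposition 3.1.5: A₁(ω), n₁(ω), the unfolded walk ω')] -/
def L5 (n : ℕ) : ℕ := L3 n + 3 * K1 (L3 n) + 4

/-- The multiplicity factor of the chain. [cite: Beaton2014RotatedHoneycomb, §3.1 (arXiv v3 p. 12: "e^{c√n}")] -/
def chainFactor (n : ℕ) (y : ℝ) : ℝ :=
  (((n : ℝ) + 3 * K1 n + 1) * max 1 y⁻¹ ^ 2) ^ K1 n * (3 * max 1 y⁻¹ ^ 2) *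
    ((((L3 n : ℕ) : ℝ) + 3 * K1 (L3 n) + 1) * max 1 y⁻¹ ^ 2) ^ K1 (L3 n) * (3 * max 1 y⁻¹ ^ 2)

/-- **The unfolding inequality**: `A_n(y) ≤ Φ(n, y) · Σ_{m = n}^{L₅(n)} B^w_m(y)` — every arch is sent to an armchair wall bridge of length
in `[n, n + O(√n)]`, with at most `Φ = e^{O(√n log n)}` arches per bridge and at most `O(√n)` extra visits.
[cite: Beaton2014RotatedHoneycomb, §3.1, proof of Proposition 7 (arXiv v3 p. 13: "C^+_n(y) ≤ 4(1+1/y²) max_i e^{c√(s_i(n))} U^+_{s_i(n)}(y)"); HammersleyTorrieWhittington1982, §2] -/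
theorem Aw_le_chain (hy : 0 < y) (n : ℕ) : Aw n y ≤ chainFactor n y * ∑ m ∈ Finset.Icc n (L5 n), WB m y := by
  set Kc := max 1 y⁻¹ ^ 2 with hKc
  have hKc0 : (0 : ℝ) ≤ Kc := pow_nonneg (zero_le_one.trans (le_max_left _ _)) _
  have hKc1 : (1 : ℝ) ≤ Kc := one_le_pow₀ (le_max_left _ _)
  -- stage 0
  set S0 := archSt n with hS0
  have P0 : ∀ σ ∈ S0, Good σ ∧ σ.1 = n ∧ σ.2 σ.1 0 = 0 := by
    intro σ hσ
    obtain ⟨ω, hω, rfl⟩ := Finset.mem_image.1 hσ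
    exact ⟨(mem_arches.1 hω).1, rfl, (mem_arches.1 hω).2⟩
  -- stage 1: unfold the top
  set S1 := S0.image (ust^[K1 n]) with hS1
  have h01 : ∑ σ ∈ S0, y ^ vis σ ≤ (((n : ℝ) + 3 * K1 n + 1) * Kc) ^ K1 n * ∑ σ ∈ S1, y ^ vis σ :=
    sum_iterate_le hy (K1 n) S0 n fun σ hσ => ⟨(P0 σ hσ).1, (P0 σ hσ).2.1.le⟩
  have P1 : ∀ σ ∈ S1, TopArch σ ∧ n ≤ σ.1 ∧ σ.1 ≤ n + 3 * K1 n := by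
    intro σ hσ
    obtain ⟨τ, hτ, rfl⟩ := Finset.mem_image.1 hσ
    obtain ⟨hg, hl, he⟩ := P0 τ hτ
    obtain ⟨-, h1, h2, -⟩ := iterate_spec hg (K1 n)
    exact ⟨topArch_iterate hg he (by rw [hl]; exact two_mul_lt_K1 n), by omega, by omega⟩
  -- stage 2: strictify
  set S2 := S1.image vst with hS2
  have h12 : ∑ σ ∈ S1, y ^ vis σ ≤ ((((2 : ℕ) : ℝ) + 1) * max 1 y⁻¹ ^ 2) * ∑ σ ∈ S2, y ^ vis σ :=
    sum_pow_le_of_fibre S1 vst vcase vis vis 2 2 hy (fun σ _ => vcase_le σ)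
      (fun σ₁ h₁ σ₂ h₂ hc he => vst_inj (P1 σ₁ h₁).1 (P1 σ₂ h₂).1 hc he)
      (fun σ hσ => by obtain ⟨-, -, -, v1, v2, -⟩ := vst_spec (P1 σ hσ).1; exact ⟨v1, v2⟩)
  have P2 : ∀ σ ∈ S2, StrictTopArch σ ∧ n + 1 ≤ σ.1 ∧ σ.1 ≤ L3 n := by
    intro σ hσ
    obtain ⟨τ, hτ, rfl⟩ := Finset.mem_image.1 hσ
    obtain ⟨hT, hl1, hl2⟩ := P1 τ hτ
    obtain ⟨hst, h1, h2, -⟩ := vst_spec hT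
    exact ⟨hst, by omega, by rw [L3]; omega⟩
  -- stage 3: reverse
  set S3 := S2.image rst with hS3
  have h23 : ∑ σ ∈ S2, y ^ vis σ ≤ ((((0 : ℕ) : ℝ) + 1) * max 1 y⁻¹ ^ 0) * ∑ σ ∈ S3, y ^ vis σ :=
    sum_pow_le_of_fibre S2 rst (fun _ => 0) vis vis 0 0 hy (fun _ _ => le_rfl)
      (fun σ₁ h₁ σ₂ h₂ _ he => rst_inj (P2 σ₁ h₁).1 (P2 σ₂ h₂).1 he)
      (fun σ hσ => by obtain ⟨-, -, -, -, v, -⟩ := rst_spec (P2 σ hσ).1; rw [vis, vis, v]; exact ⟨le_rfl, by omega⟩)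
  have P3 : ∀ σ ∈ S3, Good σ ∧ σ.2 σ.1 0 = 0 ∧ (∀ i, 1 ≤ i → i ≤ σ.1 → 1 ≤ σ.2 i 1) ∧ n + 1 ≤ σ.1 ∧ σ.1 ≤ L3 n := by
    intro σ hσ
    obtain ⟨τ, hτ, rfl⟩ := Finset.mem_image.1 hσ
    obtain ⟨hT, hl1, hl2⟩ := P2 τ hτ
    obtain ⟨hg, hlen, hend, -, -, hb⟩ := rst_spec hT
    exact ⟨hg, hend, hb, by rw [hlen]; exact hl1, by rw [hlen]; exact hl2⟩
  -- stage 4: unfold the (old) bottom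
  set S4 := S3.image (ust^[K1 (L3 n)]) with hS4
  have h34 : ∑ σ ∈ S3, y ^ vis σ ≤ ((((L3 n : ℕ) : ℝ) + 3 * K1 (L3 n) + 1) * Kc) ^ K1 (L3 n) * ∑ σ ∈ S4, y ^ vis σ :=
    sum_iterate_le hy (K1 (L3 n)) S3 (L3 n) fun σ hσ => ⟨(P3 σ hσ).1, (P3 σ hσ).2.2.2.2⟩
  have P4 : ∀ σ ∈ S4, TopArch σ ∧ (∀ i, 1 ≤ i → i ≤ σ.1 → 1 ≤ σ.2 i 1) ∧ n + 1 ≤ σ.1 ∧ σ.1 ≤ L3 n + 3 * K1 (L3 n) := by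
    intro σ hσ
    obtain ⟨τ, hτ, rfl⟩ := Finset.mem_image.1 hσ
    obtain ⟨hg, he, hb, hl1, hl2⟩ := P3 τ hτ
    obtain ⟨-, h1, h2, -, -, -, hbot⟩ := iterate_spec hg (K1 (L3 n))
    have hK : 2 * τ.1 < K1 (L3 n) * (K1 (L3 n) - 1) := by
      have h := two_mul_lt_K1 (L3 n)
      have hm := K1_mono hl2
      have : K1 τ.1 * (K1 τ.1 - 1) ≤ K1 (L3 n) * (K1 (L3 n) - 1) := Nat.mul_le_mul hm (by omega)
      have := two_mul_lt_K1 τ.1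
      omega
    exact ⟨topArch_iterate hg he hK, hbot hb, by omega, by omega⟩
  -- stage 5: strictify
  set S5 := S4.image vst with hS5
  have h45 : ∑ σ ∈ S4, y ^ vis σ ≤ ((((2 : ℕ) : ℝ) + 1) * max 1 y⁻¹ ^ 2) * ∑ σ ∈ S5, y ^ vis σ :=
    sum_pow_le_of_fibre S4 vst vcase vis vis 2 2 hy (fun σ _ => vcase_le σ)
      (fun σ₁ h₁ σ₂ h₂ hc he => vst_inj (P4 σ₁ h₁).1 (P4 σ₂ h₂).1 hc he)
      (fun σ hσ => by obtain ⟨-, -, -, v1, v2, -⟩ := vst_spec (P4 σ hσ).1; exact ⟨v1, v2⟩)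
  have P5 : ∀ σ ∈ S5, σ.2 ∈ wb σ.1 ∧ n ≤ σ.1 ∧ σ.1 ≤ L5 n := by
    intro σ hσ
    obtain ⟨τ, hτ, rfl⟩ := Finset.mem_image.1 hσ
    obtain ⟨hT, hb, hl1, hl2⟩ := P4 τ hτ
    obtain ⟨hst, h1, h2, -, -, hbot⟩ := vst_spec hT
    exact ⟨mem_wb_of_state hst (hbot hb) (by omega), by omega, by rw [L5]; omega⟩
  -- the final sum is a sum of `B^w_m`
  have h5 : ∑ σ ∈ S5, y ^ vis σ ≤ ∑ m ∈ Finset.Icc n (L5 n), WB m y := by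
    set T := (Finset.Icc n (L5 n)).biUnion fun m => (wb m).image fun ω => ((m, ω) : St) with hT
    have hsub : S5 ⊆ T := by
      intro σ hσ
      obtain ⟨hw, hl1, hl2⟩ := P5 σ hσ
      exact Finset.mem_biUnion.2 ⟨σ.1, Finset.mem_Icc.2 ⟨hl1, hl2⟩, Finset.mem_image.2 ⟨σ.2, hw, rfl⟩⟩
    have hdisj : Set.PairwiseDisjoint (↑(Finset.Icc n (L5 n)) : Set ℕ) fun m => (wb m).image fun ω => ((m, ω) : St) := by
      intro m _ m' _ hne
      rw [Function.onFun, Finset.disjoint_left]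
      intro σ h1 h2
      obtain ⟨ω, -, rfl⟩ := Finset.mem_image.1 h1
      obtain ⟨ω', -, e⟩ := Finset.mem_image.1 h2
      exact hne (Prod.mk.inj e).1.symm
    calc ∑ σ ∈ S5, y ^ vis σ ≤ ∑ σ ∈ T, y ^ vis σ := Finset.sum_le_sum_of_subset_of_nonneg hsub fun _ _ _ => pow_nonneg hy.le _
      _ = ∑ m ∈ Finset.Icc n (L5 n), ∑ σ ∈ (wb m).image (fun ω => ((m, ω) : St)), y ^ vis σ := Finset.sum_biUnion hdisj
      _ = ∑ m ∈ Finset.Icc n (L5 n), WB m y := by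
          refine Finset.sum_congr rfl fun m _ => ?_
          rw [Finset.sum_image (fun ω _ ω' _ h => (Prod.mk.inj h).2)]
          rfl
  -- assemble
  have hsum5 : 0 ≤ ∑ m ∈ Finset.Icc n (L5 n), WB m y := Finset.sum_nonneg fun _ _ => WB_nonneg _ hy.le
  have hs4 : 0 ≤ ∑ σ ∈ S4, y ^ vis σ := Finset.sum_nonneg fun _ _ => pow_nonneg hy.le _
  have hs3 : 0 ≤ ∑ σ ∈ S3, y ^ vis σ := Finset.sum_nonneg fun _ _ => pow_nonneg hy.le _
  have hs2 : 0 ≤ ∑ σ ∈ S2, y ^ vis σ := Finset.sum_nonneg fun _ _ => pow_nonneg hy.le _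
  have hA : (0 : ℝ) ≤ (((n : ℝ) + 3 * K1 n + 1) * Kc) ^ K1 n := pow_nonneg (mul_nonneg (by positivity) hKc0) _
  have hB : (0 : ℝ) ≤ 3 * Kc := by positivity
  have hC : (0 : ℝ) ≤ ((((L3 n : ℕ) : ℝ) + 3 * K1 (L3 n) + 1) * Kc) ^ K1 (L3 n) := pow_nonneg (mul_nonneg (by positivity) hKc0) _
  rw [Aw_eq_sum_archSt, chainFactor]
  rw [show (((2 : ℕ) : ℝ) + 1) * max 1 y⁻¹ ^ 2 = 3 * Kc by rw [hKc]; norm_num] at h12 h45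
  rw [show (((0 : ℕ) : ℝ) + 1) * max 1 y⁻¹ ^ 0 = 1 by norm_num, one_mul] at h23
  calc ∑ σ ∈ S0, y ^ vis σ ≤ (((n : ℝ) + 3 * K1 n + 1) * Kc) ^ K1 n * ∑ σ ∈ S1, y ^ vis σ := h01
    _ ≤ (((n : ℝ) + 3 * K1 n + 1) * Kc) ^ K1 n * (3 * Kc * ∑ σ ∈ S2, y ^ vis σ) := mul_le_mul_of_nonneg_left h12 hA
    _ ≤ (((n : ℝ) + 3 * K1 n + 1) * Kc) ^ K1 n * (3 * Kc * ∑ σ ∈ S3, y ^ vis σ) :=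
        mul_le_mul_of_nonneg_left (mul_le_mul_of_nonneg_left h23 hB) hA
    _ ≤ (((n : ℝ) + 3 * K1 n + 1) * Kc) ^ K1 n * (3 * Kc * (((((L3 n : ℕ) : ℝ) + 3 * K1 (L3 n) + 1) * Kc) ^ K1 (L3 n) * ∑ σ ∈ S4, y ^ vis σ)) :=
        mul_le_mul_of_nonneg_left (mul_le_mul_of_nonneg_left h34 hB) hA
    _ ≤ (((n : ℝ) + 3 * K1 n + 1) * Kc) ^ K1 n * (3 * Kc * (((((L3 n : ℕ) : ℝ) + 3 * K1 (L3 n) + 1) * Kc) ^ K1 (L3 n) * (3 * Kc * ∑ σ ∈ S5, y ^ vis σ))) :=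
        mul_le_mul_of_nonneg_left (mul_le_mul_of_nonneg_left (mul_le_mul_of_nonneg_left h45 hC) hB) hA
    _ ≤ (((n : ℝ) + 3 * K1 n + 1) * Kc) ^ K1 n * (3 * Kc * (((((L3 n : ℕ) : ℝ) + 3 * K1 (L3 n) + 1) * Kc) ^ K1 (L3 n) * (3 * Kc * ∑ m ∈ Finset.Icc n (L5 n), WB m y))) :=
        mul_le_mul_of_nonneg_left (mul_le_mul_of_nonneg_left (mul_le_mul_of_nonneg_left (mul_le_mul_of_nonneg_left h5 hB) hC) hB) hA
    _ = _ := by rw [hKc]; ring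


/-! ### The factor is `e^{O(√n log n)}`: crude bounds in `t = ⌊√n⌋`, and the face «ARM-ARCH-BOUND» -/

/-- `⌊√(2n)⌋ ≤ 2⌊√n⌋ + 1`. [cite: MadrasSlade1993, §3.1 (proof of Proposition 3.1.5: A₁(ω), n₁(ω), the unfolded walk ω')] -/
theorem sqrt_two_mul_le (n : ℕ) : Nat.sqrt (2 * n) ≤ 2 * Nat.sqrt n + 1 := by
  have h := Nat.lt_succ_sqrt' n
  have : 2 * n < (2 * Nat.sqrt n + 2) ^ 2 := by nlinarith
  have := Nat.sqrt_lt'.2 this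
  omega

/-- Crude bounds of the chain's parameters in `t = ⌊√n⌋`: `n + 1 ≤ (t+1)²`, `K₁(n) ≤ 3(t+1)`, `L₃(n) ≤ 14(t+1)²`, `K₁(L₃(n)) ≤ 7(t+1)`,
`L₅(n) − n ≤ 38(t+1)`. [cite: MadrasSlade1993, §3.1 (proof of Proposition 3.1.5: A₁(ω), n₁(ω), the unfolded walk ω')] -/
theorem chain_params_le (n : ℕ) :
    n + 1 ≤ (Nat.sqrt n + 1) ^ 2 ∧ K1 n ≤ 3 * (Nat.sqrt n + 1) ∧ L3 n ≤ 14 * (Nat.sqrt n + 1) ^ 2 ∧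
      K1 (L3 n) ≤ 7 * (Nat.sqrt n + 1) ∧ L5 n ≤ n + 38 * (Nat.sqrt n + 1) := by
  set t := Nat.sqrt n with ht
  have h1 : n + 1 ≤ (t + 1) ^ 2 := by have := Nat.lt_succ_sqrt' n; rw [← ht, Nat.succ_eq_add_one] at this; omega
  have h2 : K1 n ≤ 3 * (t + 1) := by have := sqrt_two_mul_le n; rw [← ht] at this; unfold K1; omega
  have h3 : L3 n ≤ 14 * (t + 1) ^ 2 := by unfold L3; nlinarith
  have h4 : K1 (L3 n) ≤ 7 * (t + 1) := by
    unfold K1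
    have : 2 * L3 n < (6 * (t + 1)) ^ 2 := by nlinarith
    have := Nat.sqrt_lt'.2 this
    omega
  have h5 : L5 n ≤ n + 38 * (t + 1) := by
    have e : L5 n = L3 n + 3 * K1 (L3 n) + 4 := rfl
    have e3 : L3 n = n + 3 * K1 n + 4 := rfl
    omega
  exact ⟨h1, h2, h3, h4, h5⟩

/-- **The chain factor times the bridge-sum overhead is at most `(D (t+1)²)^{58(t+1)}`**, `t = ⌊√n⌋`, `D = 1638 · max(1,1/y)² · max(1,β)`.
[cite: Beaton2014RotatedHoneycomb, §3.1 (arXiv v3 p. 12: "the number of SAWs which result in the same unfolded walk is at most e^{c√n}")] -/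
theorem chainFactor_le (b : ℝ) (n : ℕ) :
    chainFactor n y * (((L5 n : ℕ) : ℝ) - n + 1) * max 1 b ^ (L5 n - n + 3) ≤
      (1638 * max 1 y⁻¹ ^ 2 * max 1 b * ((Nat.sqrt n : ℝ) + 1) ^ 2) ^ (58 * (Nat.sqrt n + 1)) := by
  obtain ⟨h1, h2, h3, h4, h5⟩ := chain_params_le n
  set t := Nat.sqrt n with ht
  set Kc := max 1 y⁻¹ ^ 2 with hKc
  set Mb := max 1 b with hMb
  set W := 1638 * Kc * Mb * ((t : ℝ) + 1) ^ 2 with hW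
  have hKc1 : (1 : ℝ) ≤ Kc := one_le_pow₀ (le_max_left _ _)
  have hMb1 : (1 : ℝ) ≤ Mb := le_max_left _ _
  have hT1 : (1 : ℝ) ≤ ((t : ℝ) + 1) ^ 2 := one_le_pow₀ (by have : (0:ℝ) ≤ t := Nat.cast_nonneg t; linarith)
  have hW1 : (1 : ℝ) ≤ W := by
    rw [hW]
    have : (1 : ℝ) ≤ 1638 := by norm_num
    calc (1 : ℝ) = 1 * 1 * 1 * 1 := by ring
      _ ≤ 1638 * Kc * Mb * ((t : ℝ) + 1) ^ 2 := by gcongr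
  have hW0 : (0 : ℝ) ≤ W := zero_le_one.trans hW1
  have ht0 : (0 : ℝ) ≤ t := Nat.cast_nonneg t
  -- casts of the parameter bounds
  have c1 : ((n : ℝ) + 1) ≤ ((t : ℝ) + 1) ^ 2 := by exact_mod_cast h1
  have c2 : ((K1 n : ℕ) : ℝ) ≤ 3 * ((t : ℝ) + 1) := by exact_mod_cast h2
  have c3 : ((L3 n : ℕ) : ℝ) ≤ 14 * ((t : ℝ) + 1) ^ 2 := by exact_mod_cast h3
  have c4 : ((K1 (L3 n) : ℕ) : ℝ) ≤ 7 * ((t : ℝ) + 1) := by exact_mod_cast h4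
  have hL5n : n ≤ L5 n := by unfold L5 L3; omega
  have c5 : ((L5 n - n : ℕ) : ℝ) ≤ 38 * ((t : ℝ) + 1) := by
    have : L5 n - n ≤ 38 * (t + 1) := by omega
    exact_mod_cast this
  have c5' : ((L5 n : ℕ) : ℝ) - n + 1 = ((L5 n - n : ℕ) : ℝ) + 1 := by rw [Nat.cast_sub hL5n]
  -- the four kinds of factors are `≤ W^{e}`
  have base1 : ((n : ℝ) + 3 * K1 n + 1) * Kc ≤ W := by
    rw [hW]
    have : (n : ℝ) + 3 * K1 n + 1 ≤ 10 * ((t : ℝ) + 1) ^ 2 := by nlinarith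
    calc ((n : ℝ) + 3 * K1 n + 1) * Kc ≤ 10 * ((t : ℝ) + 1) ^ 2 * Kc := mul_le_mul_of_nonneg_right this (zero_le_one.trans hKc1)
      _ = 10 * Kc * 1 * ((t : ℝ) + 1) ^ 2 := by ring
      _ ≤ 1638 * Kc * Mb * ((t : ℝ) + 1) ^ 2 := by gcongr; norm_num
  have base2 : (((L3 n : ℕ) : ℝ) + 3 * K1 (L3 n) + 1) * Kc ≤ W := by
    rw [hW]
    have : ((L3 n : ℕ) : ℝ) + 3 * K1 (L3 n) + 1 ≤ 36 * ((t : ℝ) + 1) ^ 2 := by nlinarith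
    calc (((L3 n : ℕ) : ℝ) + 3 * K1 (L3 n) + 1) * Kc ≤ 36 * ((t : ℝ) + 1) ^ 2 * Kc := mul_le_mul_of_nonneg_right this (zero_le_one.trans hKc1)
      _ = 36 * Kc * 1 * ((t : ℝ) + 1) ^ 2 := by ring
      _ ≤ 1638 * Kc * Mb * ((t : ℝ) + 1) ^ 2 := by gcongr; norm_num
  have base3 : 3 * Kc ≤ W := by
    rw [hW]
    calc 3 * Kc = 3 * Kc * 1 * 1 := by ring
      _ ≤ 1638 * Kc * Mb * ((t : ℝ) + 1) ^ 2 := by gcongr; norm_num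
  have base4 : ((L5 n - n : ℕ) : ℝ) + 1 ≤ W := by
    rw [hW]
    calc ((L5 n - n : ℕ) : ℝ) + 1 ≤ 39 * ((t : ℝ) + 1) ^ 2 := by nlinarith
      _ = 39 * 1 * 1 * ((t : ℝ) + 1) ^ 2 := by ring
      _ ≤ 1638 * Kc * Mb * ((t : ℝ) + 1) ^ 2 := by gcongr; norm_num
  have base5 : Mb ≤ W := by
    rw [hW]
    calc Mb = 1 * 1 * Mb * 1 := by ring
      _ ≤ 1638 * Kc * Mb * ((t : ℝ) + 1) ^ 2 := by gcongr; norm_num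
  -- assemble: exponents `3(t+1) + 1 + 7(t+1) + 1 + 1 + (38(t+1)+3) ≤ 58(t+1)`
  have e1 : (((n : ℝ) + 3 * K1 n + 1) * Kc) ^ K1 n ≤ W ^ (3 * (t + 1)) :=
    (pow_le_pow_left₀ (mul_nonneg (by positivity) (zero_le_one.trans hKc1)) base1 _).trans (pow_le_pow_right₀ hW1 h2)
  have e2 : ((((L3 n : ℕ) : ℝ) + 3 * K1 (L3 n) + 1) * Kc) ^ K1 (L3 n) ≤ W ^ (7 * (t + 1)) :=
    (pow_le_pow_left₀ (mul_nonneg (by positivity) (zero_le_one.trans hKc1)) base2 _).trans (pow_le_pow_right₀ hW1 h4)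
  have e5 : Mb ^ (L5 n - n + 3) ≤ W ^ (38 * (t + 1) + 3) :=
    (pow_le_pow_left₀ (zero_le_one.trans hMb1) base5 _).trans (pow_le_pow_right₀ hW1 (by omega))
  rw [chainFactor, c5']
  calc (((n : ℝ) + 3 * K1 n + 1) * Kc) ^ K1 n * (3 * Kc) * ((((L3 n : ℕ) : ℝ) + 3 * K1 (L3 n) + 1) * Kc) ^ K1 (L3 n) * (3 * Kc) *
        (((L5 n - n : ℕ) : ℝ) + 1) * Mb ^ (L5 n - n + 3)
      ≤ W ^ (3 * (t + 1)) * W * W ^ (7 * (t + 1)) * W * W * W ^ (38 * (t + 1) + 3) := by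
        gcongr
    _ = W ^ (48 * (t + 1) + 6) := by rw [← pow_succ, ← pow_add, ← pow_succ, ← pow_succ, ← pow_add]; congr 1; ring
    _ ≤ W ^ (58 * (t + 1)) := pow_le_pow_right₀ hW1 (by omega)

/-- `A_n(y) ≤ (D (⌊√n⌋+1)²)^{58(⌊√n⌋+1)} · β_rot(y)ⁿ`. [cite: Beaton2014RotatedHoneycomb, §3.1, proof of Proposition 7 (arXiv v3 pp. 12–14)] -/
theorem Aw_le_pow (hy : 0 < y) (n : ℕ) :
    Aw n y ≤ (1638 * max 1 y⁻¹ ^ 2 * max 1 (armRate y) * ((Nat.sqrt n : ℝ) + 1) ^ 2) ^ (58 * (Nat.sqrt n + 1)) * armRate y ^ n := by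
  have hβ := armRate_pos y
  set Mb := max 1 (armRate y) with hMb
  have hMb1 : 1 ≤ Mb := le_max_left _ _
  have hL5n : n ≤ L5 n := by unfold L5 L3; omega
  -- the bridge sum
  have hsum : ∑ m ∈ Finset.Icc n (L5 n), WB m y ≤ (((L5 n : ℕ) : ℝ) - n + 1) * Mb ^ (L5 n - n + 3) * armRate y ^ n := by
    have hterm : ∀ m ∈ Finset.Icc n (L5 n), WB m y ≤ Mb ^ (L5 n - n + 3) * armRate y ^ n := by
      intro m hm
      obtain ⟨hm1, hm2⟩ := Finset.mem_Icc.1 hm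
      calc WB m y ≤ armRate y ^ (m + 3) := WB_le_pow hy m
        _ = armRate y ^ (m + 3 - n) * armRate y ^ n := by rw [← pow_add]; congr 1; omega
        _ ≤ Mb ^ (m + 3 - n) * armRate y ^ n :=
            mul_le_mul_of_nonneg_right (pow_le_pow_left₀ hβ.le (le_max_right _ _) _) (pow_nonneg hβ.le _)
        _ ≤ Mb ^ (L5 n - n + 3) * armRate y ^ n :=
            mul_le_mul_of_nonneg_right (pow_le_pow_right₀ hMb1 (by omega)) (pow_nonneg hβ.le _)
    calc ∑ m ∈ Finset.Icc n (L5 n), WB m y ≤ #(Finset.Icc n (L5 n)) • (Mb ^ (L5 n - n + 3) * armRate y ^ n) :=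
          Finset.sum_le_card_nsmul _ _ _ hterm
      _ = (((L5 n : ℕ) : ℝ) - n + 1) * Mb ^ (L5 n - n + 3) * armRate y ^ n := by
          rw [nsmul_eq_mul, Nat.card_Icc, Nat.cast_sub (by omega)]; push_cast; ring
  have hcf : 0 ≤ chainFactor n y := by
    unfold chainFactor
    have : (0 : ℝ) ≤ max 1 y⁻¹ ^ 2 := pow_nonneg (zero_le_one.trans (le_max_left _ _)) _
    positivity
  calc Aw n y ≤ chainFactor n y * ∑ m ∈ Finset.Icc n (L5 n), WB m y := Aw_le_chain hy n
    _ ≤ chainFactor n y * ((((L5 n : ℕ) : ℝ) - n + 1) * Mb ^ (L5 n - n + 3) * armRate y ^ n) := mul_le_mul_of_nonneg_left hsum hcf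
    _ = chainFactor n y * (((L5 n : ℕ) : ℝ) - n + 1) * Mb ^ (L5 n - n + 3) * armRate y ^ n := by ring
    _ ≤ _ := mul_le_mul_of_nonneg_right (chainFactor_le (armRate y) n) (pow_nonneg hβ.le _)

/-- Exponential beats the chain factor: for `q > 1` and `D ≥ 1`, eventually in `t`, `((D (t+1)²)^{58})² ≤ q^t`. [cite: Beaton2014RotatedHoneycomb, §3.1, proof of Proposition 7 (arXiv v3 pp. 12–13: the fixed-length unfolding)] -/
theorem eventually_chain_le_pow {D q : ℝ} (hD : 1 ≤ D) (hq : 1 < q) :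
    ∀ᶠ t : ℕ in atTop, ((D * ((t : ℝ) + 1) ^ 2) ^ 58) ^ 2 ≤ q ^ t := by
  -- `(D (t+1)^2)^116 = D^116 (t+1)^232 ≤ D^116 2^232 t^232` for `t ≥ 1`, and `t^232 / q^t → 0`
  have h := (tendsto_pow_const_div_const_pow_of_one_lt 232 hq).eventually (eventually_le_nhds (show (0 : ℝ) < (D ^ 116 * 2 ^ 232)⁻¹ by positivity))
  filter_upwards [h, eventually_ge_atTop 1] with t ht ht1
  have hqt : 0 < q ^ t := pow_pos (zero_lt_one.trans hq) t
  have ht1' : (1 : ℝ) ≤ t := by exact_mod_cast ht1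
  rw [div_le_iff₀ hqt] at ht
  have hD0 : 0 < D ^ 116 * 2 ^ 232 := by positivity
  calc ((D * ((t : ℝ) + 1) ^ 2) ^ 58) ^ 2 = D ^ 116 * ((t : ℝ) + 1) ^ 232 := by ring
    _ ≤ D ^ 116 * ((2 : ℝ) * t) ^ 232 := by gcongr; linarith
    _ = (D ^ 116 * 2 ^ 232) * (t : ℝ) ^ 232 := by ring
    _ ≤ (D ^ 116 * 2 ^ 232) * ((D ^ 116 * 2 ^ 232)⁻¹ * q ^ t) := mul_le_mul_of_nonneg_left ht hD0.le
    _ = q ^ t := by rw [← mul_assoc, mul_inv_cancel₀ hD0.ne', one_mul]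

/-- **The face «ARM-ARCH-BOUND» holds**: for every `y > 0` and `r > β_rot(y)` there is `C` with `A_n(y) ≤ C rⁿ` for all `n` — Beaton's
fixed-length unfolding along the armchair surface, with multiplicity `e^{O(√n log n)}`.
[cite: Beaton2014RotatedHoneycomb, §3.1, proof of Proposition 7 (arXiv v3 pp. 12–13); HammersleyTorrieWhittington1982, §2] -/
theorem archBound_holds (hy : 0 < y) : ArchBound y := by
  intro r hr
  have hβ := armRate_pos y
  set q := r / armRate y with hq
  have hq1 : 1 < q := (one_lt_div hβ).2 hr
  have hr0 : 0 < r := hβ.trans hr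
  set D := 1638 * max 1 y⁻¹ ^ 2 * max 1 (armRate y) with hD
  have hD1 : 1 ≤ D := by
    rw [hD]
    have h1 : (1 : ℝ) ≤ max 1 y⁻¹ ^ 2 := one_le_pow₀ (le_max_left _ _)
    have h2 : (1 : ℝ) ≤ max 1 (armRate y) := le_max_left _ _
    nlinarith
  obtain ⟨T, hT⟩ := eventually_atTop.1 (eventually_chain_le_pow hD1 hq1)
  -- for `⌊√n⌋ ≥ max T 1`: `A_n ≤ rⁿ`
  have hlarge : ∀ n : ℕ, max T 1 ≤ Nat.sqrt n → Aw n y ≤ r ^ n := by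
    intro n hn
    set t := Nat.sqrt n with ht
    have ht1 : 1 ≤ t := le_trans (le_max_right _ _) hn
    have hW1 : 1 ≤ D * ((t : ℝ) + 1) ^ 2 := by
      have : (1 : ℝ) ≤ ((t : ℝ) + 1) ^ 2 := one_le_pow₀ (by have : (0:ℝ) ≤ t := Nat.cast_nonneg t; linarith)
      nlinarith
    have h1 := Aw_le_pow hy n
    rw [← hD, ← ht] at h1
    have h2 : (D * ((t : ℝ) + 1) ^ 2) ^ (58 * (t + 1)) ≤ q ^ n := by
      have htt : t * t ≤ n := by rw [ht]; exact Nat.sqrt_le n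
      calc (D * ((t : ℝ) + 1) ^ 2) ^ (58 * (t + 1)) ≤ (D * ((t : ℝ) + 1) ^ 2) ^ (58 * (2 * t)) :=
            pow_le_pow_right₀ hW1 (by omega)
        _ = (((D * ((t : ℝ) + 1) ^ 2) ^ 58) ^ 2) ^ t := by rw [← pow_mul, ← pow_mul]
        _ ≤ (q ^ t) ^ t := pow_le_pow_left₀ (by positivity) (hT t (le_trans (le_max_left _ _) hn)) t
        _ = q ^ (t * t) := by rw [← pow_mul]
        _ ≤ q ^ n := pow_le_pow_right₀ hq1.le htt
    calc Aw n y ≤ (D * ((t : ℝ) + 1) ^ 2) ^ (58 * (t + 1)) * armRate y ^ n := h1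
      _ ≤ q ^ n * armRate y ^ n := mul_le_mul_of_nonneg_right h2 (pow_nonneg hβ.le _)
      _ = r ^ n := by rw [← mul_pow, hq, div_mul_cancel₀ _ hβ.ne']
  -- the finitely many small `n`
  set N := (max T 1) ^ 2 with hN
  set C₀ := (Finset.range N).sup' ⟨0, by simp [hN]⟩ fun n => Aw n y / r ^ n with hC₀
  refine ⟨max C₀ 1, fun n => ?_⟩
  rcases Nat.lt_or_ge n N with hn | hn
  · have h1 : Aw n y / r ^ n ≤ C₀ := Finset.le_sup' (fun n => Aw n y / r ^ n) (Finset.mem_range.2 hn)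
    rw [div_le_iff₀ (pow_pos hr0 n)] at h1
    exact h1.trans (mul_le_mul_of_nonneg_right (le_max_left _ _) (pow_nonneg hr0.le _))
  · have hsq : max T 1 ≤ Nat.sqrt n := by rw [Nat.le_sqrt, ← pow_two, ← hN]; exact hn
    calc Aw n y ≤ r ^ n := hlarge n hsq
      _ = 1 * r ^ n := (one_mul _).symm
      _ ≤ max C₀ 1 * r ^ n := mul_le_mul_of_nonneg_right (le_max_right _ _) (pow_nonneg hr0.le _)

end Literature.Probability.RandomPlanarGeometry.SAW.HexBW.Arm
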